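import Summits.AtomisticToContinuum.Crystallization.Theorems.FrustratedLawDichotomyStrainedPatchHomEntryLeafHTA2QParts
import Summits.AtomisticToContinuum.Crystallization.Theorems.FrustratedLawDichotomyStrainedPatchHomEntryLeafHTA2QSVerdict

/-!
# The certificate side `htCertSideA2QS` (SHARP third-order remainder) from SEPARATE KERNEL FACTS
# (27623 `(H) HomFloor (1/625)`, hcp half; hand-1 g37; critic rows 1368 (2) / 1408 (4))

decomp-a2c hand-1 g37 (crux `AperiodicFrustratedLawGap`, stmt-AtomisticToContinuum-27623).  VERBATIM `…HomEntryLeafHTA2QParts.htCertSideA2Q_of_parts` with the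
linear-pieces fact carrying `rem3LJS c w J (htScA2F …)` (`…HomSlopeLJAffine2KitS`) instead of `rem3LJ c (hullW J w) (htScA2F …)`: ★ `htCertSideA2QS_of_parts`
(`htCertRestA2 p J c w` + three quadratic-component facts + the sharp linear-pieces fact + the far sum) and ★ `entryLeafOKHT4A2QSQDCRS_of_parts` (+ the inner tree).
The quadratic-component and far facts of a cell do NOT depend on the certificate `p`, so a cell re-certified with the sharp slope constant re-uses them.

NO definitions; 0 sorry; standard axioms.  `--supports stmt-AtomisticToContinuum-27623`.
-/

namespace Summit.AtomisticToContinuum.Crystallization.Theorems.FrustratedLawDichotomyStrainedPatchHomEntryLeafHT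

open Literature.Analysis.ValidatedNumerics.Numerics
open Summit.AtomisticToContinuum.Crystallization.Theorems.FrustratedLawDichotomyStrainedPatchHomCurvLJ (ljLabelOK naiveLJ)
open Summit.AtomisticToContinuum.Crystallization.Theorems.FrustratedLawDichotomyStrainedPatchHomSlopeLJ
open Summit.AtomisticToContinuum.Crystallization.Theorems.FrustratedLawDichotomyStrainedPatchHomSlopeLJAffine
open Summit.AtomisticToContinuum.Crystallization.Theorems.FrustratedLawDichotomyStrainedPatchHomSlopeLJAffine2Kit
open Summit.AtomisticToContinuum.Crystallization.Theorems.FrustratedLawDichotomyStrainedPatchHomSlopeLJAffine2KitS (rem3LJS)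
open Summit.AtomisticToContinuum.Crystallization.Theorems.FrustratedLawDichotomyStrainedPatchHomSlopeLJThirdSharp (slopeCheckLJA2QS)
open Summit.AtomisticToContinuum.Crystallization.Theorems.FrustratedLawDichotomyStrainedPatchHomCertTree (CertTree treeOK)
open Summit.AtomisticToContinuum.Crystallization.Theorems.FrustratedLawDichotomyStrainedPatchHomEntryFitHcpCentred (entryLeafOKHQDCRS)

/-- ★ **THE CERTIFICATE SIDE WITH THE SHARP REMAINDER FROM ITS KERNEL FACTS.** [formal bookkeeping] -/
theorem htCertSideA2QS_of_parts {p : HTCert} {Q : Fin 3 → ℤ} {Gn : ℤ} {J : Fin 3 → Fin 3 × Fin 3 → ℤ} {c w : (Fin 3 × Fin 3) ⊕ Fin 3 → ℤ}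
    (h1 : htCertRestA2 p J c w = true)
    (hq0 : quadVec2F c w J (htScA2F c w J (htNearU c w)) 0 ≤ Q 0) (hq1 : quadVec2F c w J (htScA2F c w J (htNearU c w)) 1 ≤ Q 1)
    (hq2 : quadVec2F c w J (htScA2F c w J (htNearU c w)) 2 ≤ Q 2)
    (hlin : g0LJ c (htScA2F c w J (htNearU c w)) + linLJA c w J (htScA2F c w J (htNearU c w)) + sqrtQ Q +
      rem3LJS c w J (htScA2F c w J (htNearU c w)) + naiSLJ c (hullW J w) (htSnA2F c w J (htNearU c w)) ≤ Gn)
    (hfar : Gn + htGsNA c w J (htFar1U c w) + htGsNA c w J (htFar2U c w) ≤ p.Gs) : htCertSideA2QS p Q Gn J c w = true := by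
  unfold htCertRestA2 at h1
  simp only [Bool.and_eq_true] at h1
  obtain ⟨⟨⟨⟨⟨⟨⟨hball, hjac⟩, hROK⟩, hcert⟩, hcurvM⟩, hfar1⟩, hfar2⟩, ⟨⟨hs1, hs2⟩, hs3⟩⟩ := h1
  have hguard : (htScA2F c w J (htNearU c w)).all (fun b => ljLabelOK c (hullW J w) b) = true := all_filter_self _ _
  unfold htNaiOKA2F at hs1
  unfold htCertSideA2QS htNearOKA2QS slopeCheckLJA2QS
  simp only [htScA2Q_eq, htSnA2Q_eq, Bool.and_eq_true, decide_eq_true_eq]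
  simp only [hball, hjac, hROK, hcert, hcurvM, hfar1, hfar2, hguard, hs1, hs2, hs3, hq0, hq1, hq2, hlin, hfar, and_self]

/-- ★ **THE v3 SLAB LEAF FROM ITS KERNEL FACTS** (certificate side as above + the inner tree on the confined box). [formal bookkeeping] -/
theorem entryLeafOKHT4A2QSQDCRS_of_parts {μ : ℤ} {q : Fin 4 → ℤ} {p : HTCert} {Q : Fin 3 → ℤ} {Gn : ℤ} {J : Fin 3 → Fin 3 × Fin 3 → ℤ}
    {t : CertTree ((Fin 3 × Fin 3) ⊕ Fin 3)} {c w : (Fin 3 × Fin 3) ⊕ Fin 3 → ℤ}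
    (hcert : htCertSideA2QS p Q Gn J c w = true) (htree : treeOK (hullInner (entryLeafOKHQDCRS μ q) J c) t c (htWr p c w) = true) :
    entryLeafOKHT4A2QSQDCRS μ q p Q Gn J t c w = true := by
  unfold entryLeafOKHT4A2QSQDCRS entryLeafOKHT4A2QS
  rw [hcert, htree]
  rfl

end Summit.AtomisticToContinuum.Crystallization.Theorems.FrustratedLawDichotomyStrainedPatchHomEntryLeafHT
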